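import Summits.Ventures.HodgeRepro2.T5CompactDiscreteDecomposition
import Mathlib.Analysis.Convex.Integral
import Mathlib.MeasureTheory.Function.LocallyIntegrable
import Mathlib.MeasureTheory.Integral.Bochner.ContinuousLinearMap

/-!
# T5ConvolutionNatural — the operators `η(f) = ∫ f(g) ρ(g) dg` are NATURAL

Cell pub-hodge-repro2, seat p5, Tier 5 (route/T5-N4-p5.md, N4.3 v13 (B1)–(B2)).  Row 49 proves
[DE] Lemma 9.2.7's discrete decomposition for an abstract family of compact self-adjoint
operators that are NATURAL (they map every closed `ρ`-stable subspace into itself).  This file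
supplies that property for the printed operators, the Bochner integrals
`etaOp μ ρ f v := ∫ g, f g • ρ g v ∂μ` of a unitary representation against a function `f`
(`η(f)` of [DE] §9.2, `f ∈ C_c(G)`, `μ` a Haar measure):

* `integral_mem_of_forall_mem`: the integral of an integrable function with values in a closed
  subspace lies in that subspace (finite measure; Mathlib's `Convex.integral_mem` on the
  normalised measure);
* `etaOp_mem`: for `v` in a closed stable `U` and an integrable integrand, `etaOp μ ρ f v ∈ U`
  (`[IsFiniteMeasure μ]`), and `etaOp_mem_of_hasCompactSupport` for a continuous compactly
  supported `f` against a measure finite on compacts and a strongly continuous `ρ` — the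
  integrand vanishes off the compact support, so only a finite piece of `μ` is used;
* `etaOp_comp_eq`: `η(f)` commutes with every continuous linear map commuting with the `ρ(g)`
  (Mathlib's `ContinuousLinearMap.integral_comp_comm`) — in particular with unitary equivalences
  of subrepresentations, the clause row 48's `exists_eigenvector_of_equiv` consumes.

Self-adjointness of `η(f)` for `f = f*` and its compactness on `L²(Γ\G)` stay prose [C]
([DE] Lemmas 9.2.3–9.2.6).  Mathlib only besides row 49's import chain.  Axioms: propext,
Classical.choice, Quot.sound.  README §8(d): uses an L-value-free non-vanishing device: NO.
-/

namespace Summit.Ventures.HodgeRepro2.T5ConvolutionNatural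

open MeasureTheory

variable {E : Type*} [NormedAddCommGroup E] [InnerProductSpace ℂ E] [CompleteSpace E]
variable {G : Type*} [Group G] [MeasurableSpace G]

/-! ### Integrals with values in a closed subspace -/

/-- The integral (against a finite measure) of an integrable function with values in a closed
`ℂ`-subspace `U` lies in `U`. -/
theorem integral_mem_of_forall_mem {α : Type*} [MeasurableSpace α] (μ : Measure α)
    [IsFiniteMeasure μ] (U : Submodule ℂ E) (hUc : IsClosed (U : Set E)) {F : α → E}
    (hF : ∀ a, F a ∈ U) (hint : Integrable F μ) : (∫ a, F a ∂μ) ∈ U := by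
  rcases eq_or_ne μ 0 with rfl | hμ
  · rw [integral_zero_measure]
    exact U.zero_mem
  haveI : NeZero μ := ⟨hμ⟩
  have hconv : Convex ℝ (U : Set E) := (U.restrictScalars ℝ).convex
  have hmem : (∫ a, F a ∂((μ Set.univ)⁻¹ • μ)) ∈ U :=
    hconv.integral_mem hUc (Filter.Eventually.of_forall hF)
      (hint.smul_measure (ENNReal.inv_ne_top.2 (NeZero.ne (μ Set.univ))))
  have hscale : ∫ a, F a ∂μ = (μ Set.univ).toReal • ∫ a, F a ∂((μ Set.univ)⁻¹ • μ) := by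
    rw [integral_smul_measure, smul_smul, ENNReal.toReal_inv, mul_inv_cancel₀
      (ENNReal.toReal_ne_zero.2 ⟨NeZero.ne (μ Set.univ), measure_ne_top μ _⟩), one_smul]
  rw [hscale]
  exact (U.restrictScalars ℝ).smul_mem _ hmem

/-! ### The operators `η(f)` -/

/-- The operator of `f` against `ρ`: `η(f) v := ∫ g, f g • ρ g v ∂μ` (a Bochner integral). -/
noncomputable def etaOp (μ : Measure G) (ρ : G →* (E →L[ℂ] E)) (f : G → ℂ) (v : E) : E :=
  ∫ g, f g • ρ g v ∂μ

/-- **Naturality** (finite measure): `η(f)` maps a closed `ρ`-stable subspace into itself. -/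
theorem etaOp_mem (μ : Measure G) [IsFiniteMeasure μ] (ρ : G →* (E →L[ℂ] E)) (f : G → ℂ)
    {U : Submodule ℂ E} (hUc : IsClosed (U : Set E)) (hUs : ∀ g, ∀ u ∈ U, ρ g u ∈ U) {v : E}
    (hv : v ∈ U) (hint : Integrable (fun g => f g • ρ g v) μ) : etaOp μ ρ f v ∈ U :=
  integral_mem_of_forall_mem μ U hUc (fun g => U.smul_mem (f g) (hUs g v hv)) hint

/-- **Naturality** (`f ∈ C_c(G)`, `μ` finite on compacts, `ρ` strongly continuous): `η(f)` maps a
closed `ρ`-stable subspace into itself — the integrand vanishes off the compact support of `f`. -/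
theorem etaOp_mem_of_hasCompactSupport [TopologicalSpace G] [OpensMeasurableSpace G]
    (μ : Measure G) [IsFiniteMeasureOnCompacts μ] (ρ : G →* (E →L[ℂ] E))
    (hρ : ∀ v : E, Continuous fun g => ρ g v) {f : G → ℂ} (hf : Continuous f)
    (hfc : HasCompactSupport f) {U : Submodule ℂ E} (hUc : IsClosed (U : Set E))
    (hUs : ∀ g, ∀ u ∈ U, ρ g u ∈ U) {v : E} (hv : v ∈ U) : etaOp μ ρ f v ∈ U := by
  have hcont : Continuous fun g => f g • ρ g v := hf.smul (hρ v)
  have hsupp : HasCompactSupport fun g => f g • ρ g v := hfc.smul_right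
  have hzero : ∀ g, g ∉ tsupport f → f g • ρ g v = 0 := fun g hg => by
    rw [image_eq_zero_of_notMem_tsupport hg, zero_smul]
  have hfin : IsFiniteMeasure (μ.restrict (tsupport f)) :=
    ⟨by rw [Measure.restrict_apply_univ]; exact hfc.measure_lt_top⟩
  have h1 : etaOp μ ρ f v = ∫ g in tsupport f, f g • ρ g v ∂μ :=
    (setIntegral_eq_integral_of_forall_compl_eq_zero hzero).symm
  rw [h1]
  exact integral_mem_of_forall_mem (μ.restrict (tsupport f)) U hUc
    (fun g => U.smul_mem (f g) (hUs g v hv))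
    ((hcont.integrable_of_hasCompactSupport hsupp).integrableOn)

/-- `η(f)` commutes with every continuous linear map `L` that commutes with the `ρ(g)`
(in particular with unitary equivalences of subrepresentations). -/
theorem etaOp_comp_eq (μ : Measure G) (ρ : G →* (E →L[ℂ] E)) (f : G → ℂ) (L : E →L[ℂ] E)
    (hL : ∀ g, ∀ v, L (ρ g v) = ρ g (L v)) {v : E}
    (hint : Integrable (fun g => f g • ρ g v) μ) : L (etaOp μ ρ f v) = etaOp μ ρ f (L v) := by
  unfold etaOp
  rw [← L.integral_comp_comm hint]
  congr 1
  funext g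
  rw [map_smul, hL]

end Summit.Ventures.HodgeRepro2.T5ConvolutionNatural
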